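import Summits.ValiantsHypothesis.ValiantsHypothesis.Theorems.NewtonUnitEquationsTwoProductsRankOneThreeGenLawSlicing
import HarnessLib

/-!
# Route NewtonUnitEquations — crux `TwoProducts` (stmt-ValiantsHypothesis-5906), line `relation_ladder`, rung R7b (rank one on THREE
# letters, ALL coefficient patterns `p•α = q•β + r•γ`) + rung R7c (TWO letters with torsion): the DILATED FREE LIFT — part 6/7 — the count for a non-degenerate relation and the arithmetic (T8 middle)

(T8, middle) `RelData.count` (all boxes of slice pairs) and the arithmetic `Nm8_add_two_le` … `arith_R7b` (c = 906).

val-idea-8 g3 (ideator; lens decomp), 2026-08-28.  THE GENERAL THREE-LETTER RANK-ONE LAW `p•α = q•β + r•γ` (all `p, q ≥ 1`, `r ≥ 0`):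
lift `α ↦ Y_b^q Y_c^r, β ↦ Y_b^p, γ ↦ Y_c^p` over the `p`-DILATED plane (`enumP : b ↦ β, c ↦ γ, i ↦ p•enum i`), fibres `k` with divisibility
guards `p ∣ x_b − qk`, `p ∣ x_c − rk`, letter count `B_k = k + (x_b−qk)/p + (x_c−rk)/p`, DOUBLE SLICING `(b₁, b₂) = (x_b, x_c)`, the coefficient
theorem with `Pfac · C(R + B_k − 1, B_k) · κ_k`, finite SHIFT RANK and val-lit-p3's `ShiftRank.pencilCount` BY NAME; large or absent
coefficients/letters are permutation type (R3♯).  Instances: R6b (1;1,1), R6c (2;1,1), R7a (p = 1, `visible_bound_free`), R6d = val-lit-p3's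
homogeneous shape (p = q + r, `visible_bound_hom`), and rung R7c = rank one on TWO letters with torsion `p•α = q•β` (`r = 0`, idle third letter).

PORT NOTE (val-lit-p3 g15, prover seat, helper mode `--supports stmt-ValiantsHypothesis-5906 --as helper`, no stub credit claimed; the author's
request val-width INBOX 12:15Z/12:19Z + desk RULING #279 (c)): part 6/7 of a VERBATIM Theorems-side port of val-idea-8 g3's sorry-free module
`Cruxes/TwoProducts/Lines/relation_ladder_R7b.lean` REV 2 (tree sha256 f9e10d1fedcbd387…; 1 890 lines; `lean check` rc 0, 0 sorries,
0 warnings, axioms standard).  ALL mathematics and ALL proofs are val-idea-8 g3's.  Port changes only: (i) file split + import chain;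
(ii) declarations re-declared verbatim from LANDED ports are referenced BY NAME instead — `R6b.sum_sgn`, `R6b.HSD` (+ six closure
lemmas), `R6b.hsd_binChar` (R6b port); `tab`, `sgn`, `toolBound_mono` (R6 port, parent namespace); `R7a.SIdx`, `R7a.card_SIdx`,
`R7a.msetT_apply_le`, `R7a.permType_of_rankOne_largeCoeff`, `R7a.permType_of_rankOne_absent` (R7a port); `rankOne_symm` =
`R6c.rankOneCoincidences_symm` (R6c); `wt_nsmul'` = `FormalLogLinearisation.wt_nsmul`; (iii) section variables α-renamed `I ↦ Ig`
(QIdx datum), `D ↦ Dg` (RelData datum) — forced by the gate's textual statement index (`dedup.landed`), since the R6b / R7a ports own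
same-text lemmas over `ThreeIdx` / `QIdx`; (iv) docstrings on API lemmas; (v) in part 7/7 the parameter-free `def RankOneThreeGenLaw : Prop`
and `def RankOneTwoLaw : Prop` are NOT declared (relocation rule) — the laws are stated by their LITERAL bodies as `rankOneThreeGenLaw_proof`
and `rankOneTwoLaw_proof`; `visible_bound_free` / `visible_bound_hom` keep their names and texts.  Namespace = the author's
(`…PermutationType.R7b`).  Nothing here closes the line's residual, the crux `TwoProducts` (5906) or `VP ≠ VNP`; no summit statement is proved.

Honest scope (the author's): rank one on FOUR letters with general coefficients, relations on ≥ 5 letters, one-sided `p•α = Σ qᵢ βᵢ` (R8, memo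
only) and coincidence rank ≥ 2 are NOT covered here.  Nothing here moves VP ≠ VNP; `TwoProducts` (5906) stays OPEN. [folklore]
-/

noncomputable section

-- Sub = Summit single-conjunct layout: the duplicated namespace component is mandated by the tree.
set_option linter.dupNamespace false
set_option linter.unusedSimpArgs false
set_option linter.deprecated false
set_option linter.unusedSectionVars false
set_option linter.unusedVariables false
set_option linter.unnecessarySeqFocus false

namespace Summit.ValiantsHypothesis.ValiantsHypothesis.Theorems.NewtonUnitEquations.TwoProducts.PermutationType
namespace R7b
open scoped BigOperators
open MvPolynomial

variable {σ : Type*} [Fintype σ] [DecidableEq σ]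

variable (Ig : QIdx σ)

section FreeCount
open Summit.ValiantsHypothesis.ValiantsHypothesis.Theorems.NewtonUnitEquations.TwoProducts.FormalLogLinearisation
open Summit.ValiantsHypothesis.ValiantsHypothesis.Theorems.NewtonUnitEquations.TwoProducts.PlanarCell

variable {m : ℕ} {u v : Fin m → MvPolynomial (Fin 2) ℂ} (Dg : RelData u v)

/-- **The count for a non-degenerate relation** `pα = qβ + rγ` (all three letters in the alphabet, `p, q, r ≤ m`). [folklore] -/
theorem RelData.count (hu : ∀ j, coeff 0 (u j) = 0) (hv : ∀ j, coeff 0 (v j) = 0) (hqm : Dg.q ≤ m) (hrm : Dg.r ≤ m)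
    (hpm : Dg.p ≤ m)
    (hR : RankOneCoincidences (fun j => (u j).support ∪ (v j).support)
      (Finsupp.single Dg.β Dg.q + Finsupp.single Dg.γ Dg.r) (Finsupp.single Dg.α Dg.p))
    (S : Finset Expo) (hS : ∀ l ∈ S, ∃ ξ : Fin 2 → ℝ, ValidWeight u v ξ ∧ IsStrictTop ξ ↑(tailDiff u v).support l) :
    S.card ≤ (2 * (m * m) + 1) * (2 * (m * m) + 1) * sliceBd8 m (sE u v) := by
  classical
  rcases S.eq_empty_or_nonempty with hSe | hSne
  · simp [hSe]
  obtain ⟨l₀, hl₀⟩ := hSne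
  obtain ⟨ξ₀, hval₀, htop₀⟩ := hS l₀ hl₀
  have hTne : (tailSupport u v).Nonempty := tailSupport_nonempty_of_mem u v l₀ htop₀.1
  have hsE : 0 < sE u v := Finset.card_pos.mpr hTne
  set e₀ : Expo := enum u v ⟨0, hsE⟩ with he₀def
  have he₀ : e₀ ≠ 0 := enum_ne_zero u v hu hv _
  obtain ⟨β, τ, hpencil⟩ := pencil_param e₀ he₀
  have hinj := Dg.injOn_of_rankOne hu hv hR
  have hqmm : Dg.q * m ≤ m * m := Nat.mul_le_mul_right m hqm
  have hrmm : Dg.r * m ≤ m * m := Nat.mul_le_mul_right m hrm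
  have hpmm : Dg.p * m ≤ m * m := Nat.mul_le_mul_right m hpm
  -- choices along `S`
  have hξ : ∀ x : ↥S, ∃ ξ : Fin 2 → ℝ, ValidWeight u v ξ ∧ IsStrictTop ξ ↑(tailDiff u v).support x.1 :=
    fun x => hS x.1 x.2
  choose ξf hξval hξtop using hξ
  have hpt : ∀ x : ↥S, ∃ x₀ : Fin (sE u v) →₀ ℕ, piE Dg.enumP x₀ = Dg.p • x.1 ∧ x₀ Dg.idx.a = 0 ∧
      x₀ Dg.idx.b ≤ Dg.q * m + Dg.p * m ∧ x₀ Dg.idx.c ≤ Dg.r * m + Dg.p * m ∧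
      Fsl Dg.idx (cU u v) (cV u v) (x₀ Dg.idx.b) (x₀ Dg.idx.c) (xhat Dg.idx x₀) ≠ 0 ∧
      ∀ ν : Fin (sE u v) → ℕ, ν ≠ ⇑(xhat Dg.idx x₀) → Fsl Dg.idx (cU u v) (cV u v) (x₀ Dg.idx.b) (x₀ Dg.idx.c) ν ≠ 0 →
        ∑ i, Dg.rWP (ξf x) i * ((xhat Dg.idx x₀ i : ℕ) : ℝ) < ∑ i, Dg.rWP (ξf x) i * (ν i : ℝ) :=
    fun x => Dg.sliceMin_of_visible hu hv hinj (ξf x) (hξval x) x.1 (hξtop x)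
  choose xf hxπ hxa hxb hxc hxF hxmin using hpt
  -- normalisation radii and the pencil parameter
  have hrpos : ∀ x : ↥S, 0 < -wt (ξf x) e₀ := fun x => by
    linarith [wt_enum_neg u v (ξf x) (hξval x) ⟨0, hsE⟩]
  have hnorm : ∀ x : ↥S, wt (fun k => ξf x k / (-wt (ξf x) e₀)) e₀ = -1 := fun x => by
    rw [wt_weight_div]
    have hne : wt (ξf x) e₀ ≠ 0 := by linarith [hrpos x]
    rw [div_neg, div_self hne]
  have hc : ∀ x : ↥S, ∃ c : ℝ, ∀ e : Expo, wt (fun k => ξf x k / (-wt (ξf x) e₀)) e = wt β e + c * wt τ e :=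
    fun x => hpencil _ (hnorm x)
  choose cf hcf using hc
  set U : Fin (sE u v) → ℝ := fun i => -wt β (Dg.enumP i) with hU
  set V : Fin (sE u v) → ℝ := fun i => -wt τ (Dg.enumP i) with hV
  have hUV : ∀ (x : ↥S) (i : Fin (sE u v)),
      U i + cf x * V i = Dg.rWP (ξf x) i / (-wt (ξf x) e₀) := fun x i => by
    have h := hcf x (Dg.enumP i)
    rw [wt_weight_div] at h
    rw [hU, hV]
    unfold RelData.rWP
    simp only
    rw [neg_div, h]
    ring
  have hsumUV : ∀ (x : ↥S) (ν : Fin (sE u v) → ℕ), ∑ i, (U i + cf x * V i) * (ν i : ℝ) =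
      (∑ i, Dg.rWP (ξf x) i * (ν i : ℝ)) / (-wt (ξf x) e₀) := fun x ν => by
    rw [Finset.sum_div]
    refine Finset.sum_congr rfl fun i _ => ?_
    rw [hUV x i]
    ring
  -- the key map `l ↦ ((b₁, b₂), x̂₀)` is injective
  set key : ↥S → (ℕ × ℕ) × (Fin (sE u v) → ℕ) :=
    fun x => ((xf x Dg.idx.b, xf x Dg.idx.c), ⇑(xhat Dg.idx (xf x))) with hkey
  have hinjK : Function.Injective key := by
    intro x y h
    rw [hkey] at h
    simp only [Prod.mk.injEq] at h
    have hx : xf x = xf y := by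
      rw [← xOf_xhat Dg.idx (xf x) (hxa x), ← xOf_xhat Dg.idx (xf y) (hxa y), h.1.1, h.1.2]
      exact congrArg _ h.2
    apply Subtype.ext
    exact PlanarCell.eq_of_nsmul_eq Dg.hp (by rw [← hxπ x, ← hxπ y, hx])
  set Img : Finset ((ℕ × ℕ) × (Fin (sE u v) → ℕ)) := (Finset.univ : Finset ↥S).image key with hImg
  have hcard : Img.card = S.card := by
    rw [hImg, Finset.card_image_of_injective _ hinjK, Finset.card_univ, Fintype.card_coe]
  set Box : Finset (ℕ × ℕ) := Finset.range (2 * (m * m) + 1) ×ˢ Finset.range (2 * (m * m) + 1) with hBox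
  have hfst : ∀ p ∈ Img, p.1 ∈ Box := by
    intro p hp
    obtain ⟨x, -, rfl⟩ := Finset.mem_image.mp hp
    rw [hBox, Finset.mem_product, Finset.mem_range, Finset.mem_range]
    have h1 := hxb x
    have h2 := hxc x
    rw [hkey]
    simp only
    constructor <;> omega
  have hfib : ∀ bc ∈ Box, (Img.filter fun p => p.1 = bc).card ≤ sliceBd8 m (sE u v) := by
    intro bc hbc
    rw [hBox, Finset.mem_product, Finset.mem_range, Finset.mem_range] at hbc
    have hbsum : bc.1 + bc.2 ≤ 4 * (m * m) := by omega
    set Sb : Finset (Fin (sE u v) → ℕ) := (Img.filter fun p => p.1 = bc).image Prod.snd with hSb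
    have hcardb : (Img.filter fun p => p.1 = bc).card = Sb.card := by
      rw [hSb, Finset.card_image_of_injOn]
      intro p hp p' hp' hpq
      have h1 := (Finset.mem_filter.mp (Finset.mem_coe.mp hp)).2
      have h2 := (Finset.mem_filter.mp (Finset.mem_coe.mp hp')).2
      exact Prod.ext (h1.trans h2.symm) hpq
    rw [hcardb]
    refine sliceCount Dg bc.1 bc.2 hbsum U V Sb fun μ hμ => ?_
    obtain ⟨p, hp, rfl⟩ := Finset.mem_image.mp hμ
    obtain ⟨hpI, hpb⟩ := Finset.mem_filter.mp hp
    obtain ⟨x, -, rfl⟩ := Finset.mem_image.mp hpI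
    rw [hkey] at hpb ⊢
    simp only at hpb ⊢
    have hb1 : xf x Dg.idx.b = bc.1 := by rw [← hpb]
    have hb2 : xf x Dg.idx.c = bc.2 := by rw [← hpb]
    refine ⟨?_, cf x, fun ν hν hFν => ?_⟩
    · have := hxF x
      rw [hb1, hb2] at this
      exact this
    · have hFν' : Fsl Dg.idx (cU u v) (cV u v) (xf x Dg.idx.b) (xf x Dg.idx.c) ν ≠ 0 := by rw [hb1, hb2]; exact hFν
      have hlt := hxmin x ν hν hFν'
      rw [hsumUV x, hsumUV x ν]
      exact div_lt_div_of_pos_right hlt (hrpos x)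
  rw [← hcard, Finset.card_eq_sum_card_fiberwise hfst]
  calc ∑ bc ∈ Box, (Img.filter fun p => p.1 = bc).card
      ≤ ∑ bc ∈ Box, sliceBd8 m (sE u v) := Finset.sum_le_sum hfib
    _ = (2 * (m * m) + 1) * (2 * (m * m) + 1) * sliceBd8 m (sE u v) := by
        rw [Finset.sum_const, smul_eq_mul, hBox, Finset.card_product, Finset.card_range]


/-! ### The arithmetic (no `ring` on numeral powers of `s + 2`) -/

/-- `Nm8_add_two_le` — technical lemma of the R7b dilated free-lift toolkit (val-idea-8 g3). [folklore] -/
theorem Nm8_add_two_le (m : ℕ) (hm : 1 ≤ m) : Nm8 m + 2 ≤ 32 * (m + 1) ^ 5 := by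
  unfold Nm8
  have e1 : (m + 1) ^ 2 = m * m + 2 * m + 1 := by ring
  have h1 : 4 * (m * m) + 1 ≤ 4 * (m + 1) ^ 2 := by rw [e1]; omega
  have h2 : (4 * (m * m) + 1) ^ 2 ≤ (4 * (m + 1) ^ 2) ^ 2 := Nat.pow_le_pow_left h1 2
  have e3 : (4 * (m + 1) ^ 2) ^ 2 = 16 * (m + 1) ^ 4 := by ring
  rw [e3] at h2
  have h4 : 2 * m * (4 * (m * m) + 1) ^ 2 ≤ 2 * m * (16 * (m + 1) ^ 4) := Nat.mul_le_mul_left _ h2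
  have e5 : 32 * (m + 1) ^ 5 = 2 * m * (16 * (m + 1) ^ 4) + 32 * (m + 1) ^ 4 := by ring
  have h6 : 1 ≤ (m + 1) ^ 4 := Nat.one_le_pow _ _ (by omega)
  rw [e5]
  omega

/-- `Nm8_add_two_lt` — technical lemma of the R7b dilated free-lift toolkit (val-idea-8 g3). [folklore] -/
theorem Nm8_add_two_lt (m : ℕ) (hm : 1 ≤ m) : Nm8 m + 2 < 2 ^ (5 * Nat.log 2 (m + 1) + 10) := by
  have hp1 : m + 1 < 2 ^ (Nat.log 2 (m + 1) + 1) := Nat.lt_pow_succ_log_self (by norm_num) (m + 1)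
  have h5 : (m + 1) ^ 5 < (2 ^ (Nat.log 2 (m + 1) + 1)) ^ 5 := Nat.pow_lt_pow_left hp1 (by norm_num)
  have e3 : 32 * (2 ^ (Nat.log 2 (m + 1) + 1)) ^ 5 = 2 ^ (5 * Nat.log 2 (m + 1) + 10) := by
    rw [← pow_mul, show (32 : ℕ) = 2 ^ 5 by norm_num, ← pow_add]
    congr 1
    ring
  have h1 := Nm8_add_two_le m hm
  have h8 : 32 * (m + 1) ^ 5 < 32 * (2 ^ (Nat.log 2 (m + 1) + 1)) ^ 5 := Nat.mul_lt_mul_of_pos_left h5 (by norm_num)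
  omega

/-- `logNm8_le` — technical lemma of the R7b dilated free-lift toolkit (val-idea-8 g3). [folklore] -/
theorem logNm8_le (m : ℕ) (hm : 1 ≤ m) : Nat.log 2 (Nm8 m + 2) + 1 ≤ 5 * Nat.log 2 (m + 1) + 10 := by
  have := Nat.log_lt_of_lt_pow (by omega : Nm8 m + 2 ≠ 0) (Nm8_add_two_lt m hm)
  omega

/-- `sqlog8_le` — technical lemma of the R7b dilated free-lift toolkit (val-idea-8 g3). [folklore] -/
theorem sqlog8_le (m : ℕ) (hm : 1 ≤ m) :
    (5 * Nat.log 2 (m + 1) + 10) * (5 * Nat.log 2 (m + 1) + 10) ≤ 300 * m := by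
  have hp2 : 2 ^ Nat.log 2 (m + 1) ≤ m + 1 := Nat.pow_log_le_self 2 (by omega)
  have hpp : Nat.log 2 (m + 1) < 2 ^ Nat.log 2 (m + 1) := Nat.lt_two_pow_self
  have hp3 : Nat.log 2 (m + 1) * Nat.log 2 (m + 1) ≤ 2 ^ (Nat.log 2 (m + 1) + 1) := sq_le_two_pow_succ _
  have h2p : 2 ^ (Nat.log 2 (m + 1) + 1) = 2 * 2 ^ Nat.log 2 (m + 1) := pow_succ' 2 _
  have e4 : (5 * Nat.log 2 (m + 1) + 10) * (5 * Nat.log 2 (m + 1) + 10) =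
      25 * (Nat.log 2 (m + 1) * Nat.log 2 (m + 1)) + 100 * Nat.log 2 (m + 1) + 100 := by ring
  rw [e4]
  omega

/-- `powNm8_le` — technical lemma of the R7b dilated free-lift toolkit (val-idea-8 g3). [folklore] -/
theorem powNm8_le (m : ℕ) (hm : 1 ≤ m) : (Nm8 m + 2) ^ (3 * (Nat.log 2 (Nm8 m + 2) + 1)) ≤ 2 ^ (900 * m) := by
  have hN2 := Nm8_add_two_lt m hm
  have hL := logNm8_le m hm
  have hq := sqlog8_le m hm
  calc (Nm8 m + 2) ^ (3 * (Nat.log 2 (Nm8 m + 2) + 1))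
      ≤ (2 ^ (5 * Nat.log 2 (m + 1) + 10)) ^ (3 * (Nat.log 2 (Nm8 m + 2) + 1)) := Nat.pow_le_pow_left hN2.le _
    _ ≤ (2 ^ (5 * Nat.log 2 (m + 1) + 10)) ^ (3 * (5 * Nat.log 2 (m + 1) + 10)) :=
        Nat.pow_le_pow_right (by positivity) (Nat.mul_le_mul_left _ hL)
    _ = 2 ^ (3 * ((5 * Nat.log 2 (m + 1) + 10) * (5 * Nat.log 2 (m + 1) + 10))) := by
        rw [← pow_mul]
        congr 1
        ring
    _ ≤ 2 ^ (900 * m) := Nat.pow_le_pow_right (by norm_num) (by omega)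

/-- `slices_le8` — technical lemma of the R7b dilated free-lift toolkit (val-idea-8 g3). [folklore] -/
theorem slices_le8 (m : ℕ) (hm : 1 ≤ m) : (2 * (m * m) + 1) * (2 * (m * m) + 1) ≤ 2 ^ (6 * m) := by
  have hm1 : m + 1 ≤ 2 ^ m := Nat.lt_two_pow_self
  have e1 : (m + 1) * (m + 1) = m * m + 2 * m + 1 := by ring
  have h1 : 2 * (m * m) + 1 ≤ 2 * ((m + 1) * (m + 1)) := by rw [e1]; omega
  have h2 : (m + 1) * (m + 1) ≤ 2 ^ m * 2 ^ m := Nat.mul_le_mul hm1 hm1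
  have h3 : 2 * (m * m) + 1 ≤ 2 * (2 ^ m * 2 ^ m) := h1.trans (Nat.mul_le_mul_left _ h2)
  have e2 : 2 * (2 ^ m * 2 ^ m) * (2 * (2 ^ m * 2 ^ m)) = 2 ^ (4 * m + 2) := by
    rw [show 2 * (2 ^ m * 2 ^ m) = 2 ^ (2 * m + 1) by
      rw [pow_succ, ← pow_add, show m + m = 2 * m by ring]; ring]
    rw [← pow_add]
    congr 1
    ring
  have h4 : 2 ^ (4 * m + 2) ≤ 2 ^ (6 * m) := Nat.pow_le_pow_right (by norm_num) (by omega)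
  calc (2 * (m * m) + 1) * (2 * (m * m) + 1) ≤ 2 * (2 ^ m * 2 ^ m) * (2 * (2 ^ m * 2 ^ m)) := Nat.mul_le_mul h3 h3
    _ = 2 ^ (4 * m + 2) := e2
    _ ≤ 2 ^ (6 * m) := h4

set_option exponentiation.threshold 2048 in
/-- **Arithmetic**: `(2m²+1)² · sliceBd8 ≤ 2^{c m} (s+2)^c` and `2^{13m}(s+2)^2 ≤ 2^{c m}(s+2)^c` with `c = 906`. [folklore] -/
theorem arith_R7b : ∃ c : ℕ,
    (∀ m s : ℕ, 1 ≤ m → (2 * (m * m) + 1) * (2 * (m * m) + 1) * sliceBd8 m s ≤ 2 ^ (c * m) * (s + 2) ^ c) ∧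
    (∀ m s : ℕ, 2 ^ (13 * m) * (s + 2) ^ 2 ≤ 2 ^ (c * m) * (s + 2) ^ c) := by
  refine ⟨906, fun m s hm => ?_, fun m s => ?_⟩
  · have hsl := slices_le8 m hm
    have hsA : (s + 2) ^ 3 ≤ (s + 2) ^ 906 := Nat.pow_le_pow_right (by omega) (by norm_num)
    have hpow := powNm8_le m hm
    have h2m : 2 ^ (6 * m) * 2 ^ (900 * m) ≤ 2 ^ (906 * m) := by
      rw [← pow_add]
      exact Nat.pow_le_pow_right (by norm_num) (by omega)
    unfold sliceBd8
    calc (2 * (m * m) + 1) * (2 * (m * m) + 1) * ((s + 2) ^ 3 * (Nm8 m + 2) ^ (3 * (Nat.log 2 (Nm8 m + 2) + 1)))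
        ≤ 2 ^ (6 * m) * ((s + 2) ^ 906 * 2 ^ (900 * m)) := Nat.mul_le_mul hsl (Nat.mul_le_mul hsA hpow)
      _ = 2 ^ (6 * m) * 2 ^ (900 * m) * (s + 2) ^ 906 := by
          rw [Nat.mul_comm ((s + 2) ^ 906) (2 ^ (900 * m)), ← Nat.mul_assoc]
      _ ≤ 2 ^ (906 * m) * (s + 2) ^ 906 := Nat.mul_le_mul_right _ h2m
  · exact Nat.mul_le_mul (Nat.pow_le_pow_right (by norm_num) (by omega))
      (Nat.pow_le_pow_right (by omega) (by norm_num))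

end FreeCount

end R7b
end Summit.ValiantsHypothesis.ValiantsHypothesis.Theorems.NewtonUnitEquations.TwoProducts.PermutationType

end
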